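import Summits.ABC.ABC.Theses.IUTThetaPilot
import Literature.IUT.HodgeTheaters.InitialThetaDataConditions
import Literature.IUT.LogVolume.Corollary22CondP6Transport
import Literature.IUT.LogVolume.Corollary22CondP6Five
import Literature.IUT.LogVolume.GenuineLogThetaPoint
import HarnessLib

/-!
# Crux `ThetaPartII` (stmt-ABC-19678, route IUTThetaPilot), registered stub `stub_thetaData` (child (i)):
# the two classical reductions that feed it from the `λ`-line hypotheses

Support lemmas for the REGISTERED stub `stub_thetaData` of the layer-2 skeleton `Display` (abc-iut-c312-8,
skeleton sha16 4b1374645a358877, `ledger skeleton check --crux stmt-ABC-19678`):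

  `∀ P ∈ UP, ∀ l prime, 5 ≤ l → AdmitsCore P → CondP2 P l → CondP5 P l → CondP6 P l → Cor22.ThetaDataExistsAt P l`.

[IUTchIV] Cor. 2.2 (ii), proof p. 46 (kurims Apr-2020 manuscript): (P7) builds the initial Θ-data at an
admissible `(λ, l)` from (P1), (P2), (P5), (P6); Thm. 1.10 p. 22: "[… it follows … from [IUTchI], Definition
3.1, (c), that `l ≠ 5`]"; (P4) ⟸ (P6) pp. 45–46. The cell's (P7)-constructor
`Literature.IUT.HodgeTheaters.exists_initialThetaData_of_conditions` (abc-iut-L5-t7, InitialThetaDataConditions)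
and abc-iut-S2's announced instantiation `Cor22.thetaDataExistsAt_of_conditions` take the hypotheses in the
form `7 ≤ l` and `¬ (thetaEllPt P).AdmitsLCyclic l` ((P4) for the model `E_F = W ⊗ F` of Thm. 1.10's setting).
This PROOF-ONLY file supplies exactly the two bridges from the stub's hypotheses (`5 ≤ l`, `CondP6 P l`,
`AdmitsCore P`) to those, BY NAME over landed theorems, and the resulting one-line reduction of the stub to
S2's announced signature:

* `ThetaPartII.seven_le_of_condP6` — `P ∈ UP → l prime → 5 ≤ l → CondP6 P l → 7 ≤ l`: a theta field of `P`
  exists (abc-iut-S-d1 `Cor22.exists_isThetaField`) and its `15`-torsion is rational, so (P6) fails at `l = 5`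
  (`Cor22.not_condP6_five_of_isThetaField`); `l = 6` is not prime.
* `ThetaPartII.not_admitsLCyclic_thetaEllPt_of_condP6` — `P ∈ UP → AdmitsCore P → l prime → 7 ≤ l →
  CondP6 P l → ¬ (thetaEllPt P).AdmitsLCyclic l`: `Cor22.not_admitsLCyclic_of_condP6` (Corollary22CondP6Transport:
  (P6) down to `F_tpd`, up to the Galois extension `F = F_mod(√−1, W[30]) ⊇ F_tpd` of degree prime to `l`
  (abc-iut-L5-t7 `isGalois_tpd`, `not_dvd_finrank_tpd`), across the twist `j(W ⊗ F) = j(λ)`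
  (`modelCurve_j_eq_algebraMap_jInv`), then `SL₂(𝔽_l)` moves every line).
* `ThetaPartII.stub_thetaData_of_conditions` — the registered stub FOLLOWS from any theorem of the announced
  shape `∀ P ∈ UP, ∀ l prime, 7 ≤ l → CondP2 P l → CondP5 P l → ¬ (thetaEllPt P).AdmitsLCyclic l →
  Cor22.ThetaDataExistsAt P l` (abc-iut-S2, in flight over the re-based `Cor22.ThetaVolumeDatumAt`).

Classical; TAKES NO SIDE on [IUTchIII] Cor. 3.12 (not mentioned). [cite: Mochizuki2012, IUTchIV Cor. 2.2 (ii)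
proof (P4)–(P7) pp. 45–46] [cite: Mochizuki2012, IUTchIV Thm. 1.10 p. 22] [claim: Mochizuki2012, status: disputed]
for the IUT locators only.
-/

noncomputable section

-- `Summit.<Summit>.<Problem>` is the mandated summit-side namespace (CONVENTIONS §2).
set_option linter.dupNamespace false

namespace Summit.ABC.ABC.Theorems

namespace ThetaPartII

open Literature.NumberTheory.DiophantineGeometry.GenEll
open Literature.IUT.LogVolume Literature.IUT.HodgeTheaters

/-- **`l ≠ 5`, hence `l ≥ 7`, at an admissible `(λ, l)`** ([IUTchIV] Thm. 1.10 p. 22: "it follows … from [IUTchI],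
Definition 3.1, (c), that `l ≠ 5`"): for `λ ∈ U_X` a theta field exists (`Cor22.exists_isThetaField`) and (P6) fails
for it at `l = 5` (`Cor22.not_condP6_five_of_isThetaField`); a prime `l ≥ 5` with `l ≠ 5` is `≥ 7`.
[cite: Mochizuki2012, IUTchIV Thm. 1.10 p. 22] -/
theorem seven_le_of_condP6 {P : NFPoint} (hP : P ∈ UP) {l : ℕ} (hl : l.Prime) (h5 : 5 ≤ l)
    (h6 : Cor22.CondP6 P l) : 7 ≤ l := by
  have hne : l ≠ 5 := by
    rintro rfl
    obtain ⟨F', hNF, hF'⟩ := Cor22.exists_isThetaField P hP.1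
    exact Cor22.not_condP6_five_of_isThetaField hP.1 F' hF' h6
  have hne6 : l ≠ 6 := by
    rintro rfl
    exact absurd hl (by decide)
  omega

/-- **(P6) ⟹ (P4) for the model `E_F = W ⊗ F` of Thm. 1.10's setting at the point** ([IUTchIV] Cor. 2.2 (ii) proof
pp. 45–46): for `λ ∈ U_X` admitting a core, a prime `l ≥ 7` with `Cor22.CondP6 P l`, the curve
`thetaEllPt P = (F_mod(√−1, W[30]), W ⊗ F)` admits no `l`-cyclic subgroup scheme — by
`Cor22.not_admitsLCyclic_of_condP6` at the Galois extension `F ⊇ F_tpd` of degree prime to `l`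
(`isGalois_tpd`, `not_dvd_finrank_tpd`) and `j(W ⊗ F) = j(λ)` (`modelCurve_j_eq_algebraMap_jInv`).
[cite: Mochizuki2012, IUTchIV Cor. 2.2 (ii) proof (P4)(P6) pp. 45–46] -/
theorem not_admitsLCyclic_thetaEllPt_of_condP6 (P : NFPoint) (hP : P ∈ UP) (hcore : Cor22.AdmitsCore P)
    {l : ℕ} (hl : l.Prime) (h7 : 7 ≤ l) (h6 : Cor22.CondP6 P l) : ¬ (thetaEllPt P).AdmitsLCyclic l := by
  haveI : Fact l.Prime := ⟨hl⟩
  letI := tpdAlgebra P hP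
  haveI := isGalois_tpd P hP
  exact Cor22.not_admitsLCyclic_of_condP6 hP.1 hcore (by omega) h6 (FTheta P) (not_dvd_finrank_tpd P hP hl h7)
    (ETheta P) (modelCurve_j_eq_algebraMap_jInv P hP)

/-- **The registered stub `stub_thetaData` reduced to the announced existence theorem**: if for every `P ∈ UP`
and prime `l ≥ 7` with (P2), (P5) and (P4) for `E_F = W ⊗ F` a genuine Θ-volume datum exists at `(P, l)`
(abc-iut-S2's `Cor22.thetaDataExistsAt_of_conditions`, in flight), then `stub_thetaData` holds with its
registered hypotheses (`5 ≤ l`, `AdmitsCore`, (P2), (P5), (P6)). Pure bookkeeping over the two lemmas above.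
[cite: Mochizuki2012, IUTchIV Cor. 2.2 (ii) proof (P7) p. 46] -/
theorem stub_thetaData_of_conditions
    (H : ∀ P : NFPoint, P ∈ UP → ∀ l : ℕ, l.Prime → 7 ≤ l →
      Cor22.CondP2 P l → Cor22.CondP5 P l → ¬ (thetaEllPt P).AdmitsLCyclic l → Cor22.ThetaDataExistsAt P l) :
    ∀ P : NFPoint, P ∈ UP → ∀ l : ℕ, l.Prime → 5 ≤ l →
      Cor22.AdmitsCore P → Cor22.CondP2 P l → Cor22.CondP5 P l → Cor22.CondP6 P l →
        Cor22.ThetaDataExistsAt P l := by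
  intro P hP l hl h5 hcore h2 hP5 h6
  have h7 : 7 ≤ l := seven_le_of_condP6 hP hl h5 h6
  exact H P hP l hl h7 h2 hP5 (not_admitsLCyclic_thetaEllPt_of_condP6 P hP hcore hl h7 h6)

end ThetaPartII

end Summit.ABC.ABC.Theorems

end
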